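import Summits.QuantumFields.BalabanUV.T4Continuum.Support.NE9CurChartTowerPiLatticeUniform
import Literature.MathematicalPhysics.QuantumFieldTheory.Balaban1983to89.B11Eq44COperatorTowerGeometric
import Literature.MathematicalPhysics.QuantumFieldTheory.Balaban1983to89.B9Thm311LaplaceAkPositiveDiagonal
import Literature.MathematicalPhysics.QuantumFieldTheory.Balaban1983to89.B9Eq326OperatorTowerRealityUnitary
import Literature.MathematicalPhysics.QuantumFieldTheory.Balaban1983to89.B9Eq342GreenPrimeSupBound

/-!
# NE9CurChartTowerPiLatticeUniformClass — THE LATTICE-UNIFORM CHART OF `cur U` ON PRINT's SMALL-FIELD CLASS: for every height `k = n+1`, spacing on the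
# diagonal, period `m` and every UNITARY background `U` of a C⋆-algebra in print's windows (3.35)–(3.36) (`‖U(b) − 1‖ ≤ αη`, `‖U(∂p) − 1‖ ≤ αη²`,
# `‖U(x,μ) − U(x−e_μ,μ)‖ ≤ αη²`, the current `‖J‖ ≤ j₀ ≤ j₁`), the k-level `cur U` chart at PRINT's operator (3.122) exists ON ONE BALL whose radii
# were fixed BEFORE the lattice — `Support/NE9CurChartTowerPiLatticeUniform.cur_chart_exists_tower_pi_lattice_uniform` (this seat, (I-5): the chart on
# the MODEL block) WITH THE MODEL BLOCK PRODUCED: the per-level `U1` ∕ regularity data at the GEOMETRIC profile `αU j = αT·L^{−2·min(j+1,n+1)}` with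
# `Σ_{j<n+1} αU j ≤ αT∕3` height-free ((I-6) `B11Eq44COperatorTowerGeometric`), the bond-deviation profile `εU ≤ Kα·L^{−j}` (the owner's feed
# `B7Eq43AveragedSmallnessLinearFeed`), unitarity of every level background (`B9Eq326OperatorTowerRealityUnitary.UlevOf_star_eq_inv` ⟹ norm-preserving
# fibre transporters `B9Eq342GreenPrimeSupBound.norm_adTransportW_eq`), the positivity witnesses (`B9Thm311SitePrimeFormCoerciveTowerCanonical`,
# `B9Thm311LaplaceAkPositiveDiagonal`, `B9Thm311LaplaceAkPiPositiveDiagonal` — all `∃ α₀` first), the right inverse (`QkW_surjective`); cell `pub-balaban`,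
# T4-DAG §2 node U3 ∕ §6 NE9, route R2′; NE9 crux-team (2) leaf prover 01 (`b2b-balaban-t4-ne9-formalise-leaf-01`, gen 96); Summits-side NEW sibling leaf
# under this seat's INTERFACE REQUEST NE9 [NE9LEAF01-G96-IFR] (HOME/INBOX.md L.74921; ruling e34b3e0c (0)); nothing printed asserted

HONEST FRAMING (T4-DAG PAGE 1).  Rung (B)+1 of the FINITE-VOLUME T⁴ programme — NOT infinite volume, NOT a mass gap, NOT the Clay problem.  NE9 is a
cell NEW ESTIMATE, NOT PRINTED in [Balaban1987RG1] ∕ [Balaban1988RG2Cluster], and NOT PROVED here («NE9 ⇐ the named binders»; spine PROVED 0∕9).  HONEST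
DEPENDENCY (cell line, verbatim): continuum YM on T⁴ ⇐ BetaPertH ∧ nine spine estimates (0/9 proved); BetaPertH ⇐ (D1) ∧ (D4) ∧ CAP+tail; G-an2-4
gates asym, D1 and NE2/3/4.  The `cur U` OBJECT is ONE item of the MODEL O-NE9-1 (species (a) data); `act` ∕ `ker` and NEEDS-COORDINATOR #5 untouched.

WHAT THIS FILE PROVES (ONE theorem; 0 def, 0 sorry, axioms standard).  **`cur_chart_exists_tower_pi_of_unitary_class_lattice_uniform`** — for fixed `L ≥ 3`,
a finite-dimensional non-trivial C⋆-algebra `𝔸` with the fibre ∕ trace letters `φ, M_φ, M_φ′, τ, C_τ, M_τ`, print's parameters `a, a′ > 0`, the window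
letter `α₀` of [Balaban1985Averaging] Prop. 2 with `C_k`'s numerics `ρ` and the surjectivity regime `50(d+1)·αT·L^d ≤ 1∕2`, the room `ρ_w ≥ 0`, the (L3)
constants `(C₄, a₃)` and the weight-profile bounds `ω, Ω ≥ 0`: `∃ α₁ j₁ ε₄ ε_C R_b R′` (`α₁, j₁, R_b, R′ > 0`) BEFORE `∀`, such that for EVERY `n`, `η` with
`ηL^{n+1} = 1`, weights `c₀L^{(n+1)d} = c₁`, `c₀ = η^d`, `|η|^d∕c₀ ≤ ρ_w`, period `m ≥ 1`, and EVERY background `U` with `Ũ ∈ unitaryUnits 𝔸`, `0 ≤ α ≤ α₁` and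
print's windows (3.35)–(3.36) as above, level maps with `n+1 ≤ lev₀`, weight profile `w̄₀, w̄₁ ≤ ω`, `w̲₃⁻¹, w̲_B⁻¹ ≤ Ω`, every admissible (L3) slot `Wq`:
`∃ h52 hpos′ hposπ` (PRODUCED) and the triple (Ψ1)–(Ψ3) for the chart `chartHB 𝔊̃_k 0 Wq 0 (A′ ↦ A′ + solA H̃_{1,k} 0 C_k 0 ε_C A′) ε₄ H̃_{1,k}` at print's operator
`laplaceAkPi` taken AT THE PRODUCED per-level data (geometric profile) and the right inverse `QkW_surjective`.
PROOF: the seven `∃`-first suppliers before `∀`; the feed below the least threshold; (I-5) at `ϱ := 1∕L`, `AQ := αT∕3`, `G := unitaryUnits 𝔸`; per lattice the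
block's fifty letters produced as listed and (I-5) applied at `α := Kα` (`K = 1 + 512(d+1)(d+4)`).
DISGUISE TEST: composition by name; no inequality of the series proved HERE; what stays DISPLAYED is print's class itself (unitarity, the three windows, the
current window), the diagonal bookkeeping `c₀ = η^d`, the weight-profile bounds and the (L3) `W`; constants crude and symbolic; NOT the gauge step of p. 416, NOT
the two-background chart, NOT claimed that Bałaban's 𝐇_k ∕ U_j(□₀, exp iB) meet these letters (O-NE9-1; #5 UNRULED); not NE9.  What IS new: the k-level chart
on print's class with NO radius depending on the height, the spacing or the period.
References (TYPES ∕ loci only): [Balaban1985Variational] (44)–(47) p. 285, (103) p. 293, Prop. 6 (117)–(121) p. 295, (172)–(175) p. 305; [Balaban1985BackgroundPropagators]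
(3.35)–(3.37) p. 396, Thm 3.1 (3.42)∕(3.47) pp. 397–398, Thm 3.11 p. 416, (3.122)–(3.126) p. 420, Thm 3.12 p. 423, (3.153) p. 426, Thm 3.13 p. 426; [Balaban1985Averaging]
Prop. 2 (52)–(54) p. 26, p. 37.
-/

noncomputable section

open Metric Set

namespace Summit.QuantumFields.BalabanUV.T4Continuum.NE9CurChartTowerPiLatticeUniformClass

open scoped InnerProductSpace ComplexConjugate BigOperators
open Literature.MathematicalPhysics.QuantumFieldTheory.Balaban1983to89
open B11Eq103H1Complex B11Eq115Space B11Eq174Chart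
open B11Eq111FrakG (nabla115)
open B13Contraction113 (QuadAnalytic)
open B9SectCLatticeCarrier (Bond bpos btgt unshift)
open B4Sect5Torus (TSite)
open B7Prop1Explicit (U1 Wcx boxVec)
open B7Prop2Explicit (pdev AvgClosed C0 c2' unitaryUnits avgClosed_unitaryUnits unitaryUnits_le_U1)
open B7Prop3Flat (c3)
open B9Eq315QTorus (perCfg cornerSite)
open B9Eq315QTower (towerP UlevOf)
open B9Eq326OperatorTower (QkW QkW_surjective laplaceAk)
open B9Eq310HessianOperator (adTransportW)
open B9Eq310DeltaPrime (plaqHolU)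
open B9Eq324DeltaPrimeATower (laplacePrimeAk)
open B9Eq3119DeltaPiTower (laplaceAkPi)
open B11Eq44COperatorTower (αT αT_le ulev_mem_U1_of_pdev)
open B11Eq44COperatorTowerGeometric (ulev_reg_of_pdev_geometric geomProfile_nonneg geomProfile_le_αT sum_geomProfile_le)
open B11Eq44CLetterTower (Cck)
open B9Thm311SmallFieldClosed (hRS_of_unitary)
open B9Eq315QTorusOnto (liftSite perSite_liftSite)
open B7Eq43AveragedSmallnessLevelFree (pdev_perCfg_le_of_plaq)
open B7Eq43AveragedSmallnessLinearFeed (twoWindows_linear_feed)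
open B9Thm311SitePrimeFormCoerciveTowerCanonical (exists_strong_site_coercive_tower_diagonal)
open B9Thm311LaplaceAkPiPositiveDiagonal (exists_laplaceAkPi_pos_diagonal_closed)
open B9Thm311LaplaceAkPositiveDiagonal (exists_laplaceAk_pos_diagonal_closed)
open B9Eq326OperatorTowerRealityUnitary (UlevOf_star_eq_inv forall_star_eq_inv_of_mem)
open B9Eq342GreenPrimeSupBound (norm_adTransportW_eq)
open Summit.QuantumFields.BalabanUV.T4Continuum.NE9CurChartTowerPiLatticeUniform (cur_chart_exists_tower_pi_lattice_uniform)

variable {d : ℕ} (hd : 1 ≤ d) (L : ℕ) [NeZero L] (hL : 1 ≤ L) (hL2 : 2 ≤ L) (hL3 : 3 ≤ L) [Fact (0 < (L : ℝ))]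
  {𝔸 : Type*} [CStarAlgebra 𝔸] [Nontrivial 𝔸] [FiniteDimensional ℂ 𝔸]
  {W : Type*} [NormedAddCommGroup W] [InnerProductSpace ℂ W] [FiniteDimensional ℂ W] (φ : W ≃ₗ[ℂ] 𝔸)
  {Mφ Mφ' : ℝ} (hMφ : 0 ≤ Mφ) (hMφ' : 0 ≤ Mφ') (hφ : ∀ w, ‖φ w‖ ≤ Mφ * ‖w‖) (hφ' : ∀ X, ‖φ.symm X‖ ≤ Mφ' * ‖X‖)
  {a : ℝ} (ha : 0 < a) {a' : ℝ} (ha' : 0 < a')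
  (τ : 𝔸 →ₗ[ℂ] ℂ) {Cτ : ℝ} (hτ : ∀ X, ‖τ X‖ ≤ Cτ * ‖X‖) (hCτ : 0 ≤ Cτ) {Mτ : ℝ} (hτm : ∀ X Y : 𝔸, ‖τ (X * Y)‖ ≤ Mτ * ‖X‖ * ‖Y‖) (hMτ : 0 ≤ Mτ)
  {ρw : ℝ} (hρw : 0 ≤ ρw)
  (hτ₁ : ∀ X : 𝔸, τ (star X) = conj (τ X)) (hτ₂ : ∀ X Y : 𝔸, τ (X * Y) = τ (Y * X)) (hφτ : ∀ X Y : 𝔸, ⟪φ.symm X, φ.symm Y⟫_ℂ = τ (star X * Y))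
  {α₀ : ℝ} (hα₀ : 0 < α₀) (hα3 : C0 d * α₀ ≤ 1 / 3) (hα4 : 4 * α₀ ≤ c2' d L)
  (hαL : 50 * (d + 1) * αT d L α₀ * (L : ℝ) ^ d ≤ 1 / 2)
  {ρ : ℝ} (hρ0 : 0 < ρ) (hρ : Real.exp (4 * (800 * ((d : ℝ) + 1) ^ 2 * ((d : ℝ) + 4)) * α₀) * (1 + 8 * (131072 * ((d : ℝ) + 1) ^ 2) * ρ) ≤ 2)
  (hρc : 2 * ρ ≤ c3 d L) {C₄ a₃ : ℝ} (hC₄ : 0 ≤ C₄) (ha₃ : 0 < a₃) {ω Ω : ℝ} (hω : 0 ≤ ω) (hΩ : 0 ≤ Ω)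

-- deep definitional unfolding `laplaceAkPi` ↦ `laplaceALatticeK … (π†Δπ) …` in the statement (as the host)
set_option maxRecDepth 8192 in
set_option maxHeartbeats 1600000 in -- the block is PRODUCED letter by letter and (I-5)'s ≈ 60-binder theorem applied once
include hd hL2 hL3 hMφ hMφ' hφ hφ' ha ha' hτ hCτ hτm hMτ hρw hτ₁ hτ₂ hφτ hα₀ hα3 hα4 hαL hρ0 hρ hρc hC₄ ha₃ hω hΩ in
/-- **THE LATTICE-UNIFORM CHART OF `cur U` ON PRINT's SMALL-FIELD CLASS (3.35)–(3.36)** — unitary backgrounds of a C⋆-algebra in the three windows and the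
current window, of ANY height, spacing on the diagonal and period: `∃ α₁ j₁ ε₄ ε_C R_b R′` BEFORE `∀ n η m U`; `∃ h52 hpos′ hposπ` PRODUCED; then (Ψ1)–(Ψ3) for the
chart at print's operator taken at the geometric per-level profile and `QkW_surjective`.  (I-5) with its MODEL block produced by the named suppliers. [folklore]
[cite: Balaban1985BackgroundPropagators, (3.122) p.420, (3.35)–(3.37) p.396, Thm 3.11 p.416, Thm 3.12 p.423, Thm 3.13 p.426; Balaban1985Variational, (103) p.293, Prop. 6 (117)–(121) p.295, (172)–(175) p.305; Balaban1985Averaging, Prop. 2 (52)–(54) p.26, p.37] -/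
theorem cur_chart_exists_tower_pi_of_unitary_class_lattice_uniform :
    ∃ α₁ j₁ ε₄ εC Rb R' : ℝ, 0 < α₁ ∧ 0 < j₁ ∧ 0 < Rb ∧ 0 < R' ∧
      ∀ (n : ℕ) (η : ℝ) [Fact (0 < η)] (hηL : η * (L : ℝ) ^ (n + 1) = 1) (c₀ c₁ : ℝ) [Fact (0 < c₀)] [Fact (0 < c₁)]
        (_hw : c₀ * ((L : ℝ) ^ (n + 1)) ^ d = c₁) (_hc₀η : c₀ = η ^ d) (_hρ : |η| ^ d / c₀ ≤ ρw) (m : Fin d → ℕ) [∀ i, NeZero (m i)] (_hm : ∀ i, 1 ≤ m i)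
        (U : Bond d (towerP L m (n + 1)) → 𝔸ˣ) (hUG : ∀ (x : B7Prop1Explicit.Site d) (κ : Fin d), perCfg (towerP L m (n + 1)) U x κ ∈ unitaryUnits 𝔸)
        (α : ℝ) (_hα : 0 ≤ α) (_hαle : α ≤ α₁) (_hUη : ∀ b, ‖(U b : 𝔸) - 1‖ ≤ α * η)
        (_hpl : ∀ p : B9SectCLatticeCarrier.Plaq d (towerP L m (n + 1)), ‖(plaqHolU U p : 𝔸) - 1‖ ≤ α * η ^ 2)
        (_hUgrad : ∀ (x : TSite d (towerP L m (n + 1))) (μ : Fin d), ‖(U (x, μ) : 𝔸) - U (unshift μ x, μ)‖ ≤ α * η ^ 2)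
        (j₀ : ℝ) (_hJ : ∀ μ y, ‖B9Eq39Adjoint.J (fun μ => B9Eq33CovDerivVector.shiftEquiv μ) (fun μ y => U (y, μ)) η μ y‖ ≤ j₀) (_hj : j₀ ≤ j₁)
        (lev₀ : Bond d (towerP L m (n + 1)) → ℕ) (lev₁ : Bond d (towerP L m (n + 1)) × Fin d → ℕ) (levB : Bond d m → ℕ) (_hlev : ∀ b, n + 1 ≤ lev₀ b)
        (_hw₀ : (NegSup.wSup (levWeight (L : ℝ) η lev₀ 1) : ℝ) ≤ ω) (_hw₁ : (NegSup.wSup (levWeight (L : ℝ) η lev₁ 2) : ℝ) ≤ ω)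
        (_hw₃ : (NegSup.wInvSup (levWeight (L : ℝ) η lev₀ 3) : ℝ) ≤ Ω) (_hwB : (NegSup.wInvSup (levWeight (L : ℝ) η levB 0) : ℝ) ≤ Ω)
        {Wq : Space115 (L : ℝ) η lev₀ lev₁ (nabla115 η U) → NegSize (L : ℝ) η lev₀ 3 𝔸}, QuadAnalytic Wq C₄ a₃ →
        AnalyticOnNhd ℂ Wq {Y | ‖Y‖ < a₃} →
      ∃ h52 : pdev (perCfg (towerP L m (n + 1)) U) < α₀ * (((L : ℝ) ^ (n + 1))⁻¹) ^ 2,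
      ∃ hpos' : ∀ x : SiteL2K ℂ d (towerP L m (n + 1)) c₀ W, x ≠ 0 →
          0 < RCLike.re ⟪x, laplacePrimeAk L m n φ η U a' (c₁ := c₁) x⟫_ℂ,
      ∃ hposπ : ∀ x : BondL2K ℂ d (towerP L m (n + 1)) c₀ W, x ≠ 0 →
          0 < RCLike.re ⟪x, laplaceAkPi L m n φ τ η U a' hpos' hL (fun j => αT d L α₀ * (((L : ℝ) ^ min (j + 1) (n + 1))⁻¹) ^ 2)
            (fun j => (geomProfile_le_αT (d := d) L (n + 1) hL hα₀.le j).trans (αT_le hL hα4))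
            (ulev_mem_U1_of_pdev L m (n + 1) U hL2 (avgClosed_unitaryUnits d L) hUG hα₀ hα3 hα4 h52)
            (ulev_reg_of_pdev_geometric L m (n + 1) U hL2 (avgClosed_unitaryUnits d L) hUG hα₀ hα3 hα4 h52) (c₁ := c₁) a x⟫_ℂ,
        DifferentiableOn ℂ (chartHB (frakGLatticeCLM (lev₀ := lev₀) φ hposπ
              (QkW_surjective L m n φ U hL _ _ _ _ fun j => le_trans (mul_le_mul_of_nonneg_right (mul_le_mul_of_nonneg_left
                (geomProfile_le_αT (d := d) L (n + 1) hL hα₀.le j) (by positivity)) (by positivity)) hαL) lev₁ (nabla115 η U))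
            0 Wq 0 (fun A' => A' + solA (H1LatticeCLM (lev₀ := lev₀) (levB := levB) φ hposπ
              (QkW_surjective L m n φ U hL _ _ _ _ fun j => le_trans (mul_le_mul_of_nonneg_right (mul_le_mul_of_nonneg_left
                (geomProfile_le_αT (d := d) L (n + 1) hL hα₀.le j) (by positivity)) (by positivity)) hαL) lev₁ (nabla115 η U)) 0
              (Cck L m η (n + 1) U lev₀ lev₁ (nabla115 η U) levB) 0 εC A') ε₄
            (H1LatticeCLM (lev₀ := lev₀) (levB := levB) φ hposπ
              (QkW_surjective L m n φ U hL _ _ _ _ fun j => le_trans (mul_le_mul_of_nonneg_right (mul_le_mul_of_nonneg_left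
                (geomProfile_le_αT (d := d) L (n + 1) hL hα₀.le j) (by positivity)) (by positivity)) hαL) lev₁ (nabla115 η U)))
          (ball (0 : NegSize (L : ℝ) η levB 0 𝔸) Rb) ∧
        MapsTo (chartHB (frakGLatticeCLM (lev₀ := lev₀) φ hposπ
              (QkW_surjective L m n φ U hL _ _ _ _ fun j => le_trans (mul_le_mul_of_nonneg_right (mul_le_mul_of_nonneg_left
                (geomProfile_le_αT (d := d) L (n + 1) hL hα₀.le j) (by positivity)) (by positivity)) hαL) lev₁ (nabla115 η U))
            0 Wq 0 (fun A' => A' + solA (H1LatticeCLM (lev₀ := lev₀) (levB := levB) φ hposπ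
              (QkW_surjective L m n φ U hL _ _ _ _ fun j => le_trans (mul_le_mul_of_nonneg_right (mul_le_mul_of_nonneg_left
                (geomProfile_le_αT (d := d) L (n + 1) hL hα₀.le j) (by positivity)) (by positivity)) hαL) lev₁ (nabla115 η U)) 0
              (Cck L m η (n + 1) U lev₀ lev₁ (nabla115 η U) levB) 0 εC A') ε₄
            (H1LatticeCLM (lev₀ := lev₀) (levB := levB) φ hposπ
              (QkW_surjective L m n φ U hL _ _ _ _ fun j => le_trans (mul_le_mul_of_nonneg_right (mul_le_mul_of_nonneg_left
                (geomProfile_le_αT (d := d) L (n + 1) hL hα₀.le j) (by positivity)) (by positivity)) hαL) lev₁ (nabla115 η U)))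
          (ball (0 : NegSize (L : ℝ) η levB 0 𝔸) Rb) (ball (0 : Space115 (L : ℝ) η lev₀ lev₁ (nabla115 η U)) R') ∧
        chartHB (frakGLatticeCLM (lev₀ := lev₀) φ hposπ
              (QkW_surjective L m n φ U hL _ _ _ _ fun j => le_trans (mul_le_mul_of_nonneg_right (mul_le_mul_of_nonneg_left
                (geomProfile_le_αT (d := d) L (n + 1) hL hα₀.le j) (by positivity)) (by positivity)) hαL) lev₁ (nabla115 η U))
            0 Wq 0 (fun A' => A' + solA (H1LatticeCLM (lev₀ := lev₀) (levB := levB) φ hposπ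
              (QkW_surjective L m n φ U hL _ _ _ _ fun j => le_trans (mul_le_mul_of_nonneg_right (mul_le_mul_of_nonneg_left
                (geomProfile_le_αT (d := d) L (n + 1) hL hα₀.le j) (by positivity)) (by positivity)) hαL) lev₁ (nabla115 η U)) 0
              (Cck L m η (n + 1) U lev₀ lev₁ (nabla115 η U) levB) 0 εC A') ε₄
            (H1LatticeCLM (lev₀ := lev₀) (levB := levB) φ hposπ
              (QkW_surjective L m n φ U hL _ _ _ _ fun j => le_trans (mul_le_mul_of_nonneg_right (mul_le_mul_of_nonneg_left
                (geomProfile_le_αT (d := d) L (n + 1) hL hα₀.le j) (by positivity)) (by positivity)) hαL) lev₁ (nabla115 η U)) 0 = 0 := by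
  have hL0 : (0 : ℝ) < L := by exact_mod_cast lt_of_lt_of_le (by norm_num) hL2
  have hr0 : (0 : ℝ) ≤ 1 / (L : ℝ) := by positivity
  have hr1 : 1 / (L : ℝ) < 1 := by rw [div_lt_one hL0]; exact_mod_cast lt_of_lt_of_le (by norm_num) hL2
  have hstar : ∀ X : 𝔸, ‖star X‖ ≤ ‖X‖ := fun X => (norm_star X).le
  have hT0 : 0 ≤ αT d L α₀ := by unfold αT; positivity
  -- (I-5) on the MODEL block at `ϱ := 1∕L`, `AQ := αT∕3`, `G := unitaryUnits 𝔸`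
  obtain ⟨α₁, j₁, ε₄, εC, Rb, R', hα₁, hj₁, hRb0, hR'0, HC⟩ :=
    cur_chart_exists_tower_pi_lattice_uniform hd L hL hL2 hL3 φ hMφ hMφ' hφ hφ' hstar ha ha' hr0 hr1 τ hτ hCτ hτm hMτ hρw hτ₁ hτ₂ hφτ (αT d L α₀ / 3)
      (avgClosed_unitaryUnits d L) hα₀ hα3 hα4 hρ0 hρ hρc hC₄ ha₃ hω hΩ
  -- the three positivity suppliers, `∃`-first
  obtain ⟨αS, γ', hαS, hγ', HS⟩ := exists_strong_site_coercive_tower_diagonal (d := d) L φ hMφ hMφ' hφ hφ' ha' hr0 hr1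
  obtain ⟨αQ, hαQ, HQ⟩ := exists_laplaceAkPi_pos_diagonal_closed (d := d) L hL φ hMφ hMφ' hφ hφ' ha ha' hr0 hr1 τ hτ hCτ hρw
  obtain ⟨αA, hαA, HA⟩ := exists_laplaceAk_pos_diagonal_closed (d := d) L hL φ hMφ hMφ' hφ hφ' ha hr0 hr1 τ hτ hCτ hρw
  -- the α-linear two-window feed below the least threshold
  obtain ⟨T, hT, F⟩ := twoWindows_linear_feed L hL2 (d := d) (𝔸 := 𝔸) (lt_min hα₁ (lt_min hαS (lt_min hαQ hαA)))
  refine ⟨min T (α₀ / 2), j₁, ε₄, εC, Rb, R', lt_min hT (by positivity), hj₁, hRb0, hR'0, ?_⟩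
  intro n η _ hηL c₀ c₁ _ _ hw hc₀η hρ' m _ hm U hUG α hα0 hαle hUη hpl hUgrad j₀ hJ hj' lev₀ lev₁ levB hlev hw₀ hw₁ hw₃ hwB Wq hW hWa
  have hη0 : 0 < η := Fact.out
  have hαT' : α ≤ T := hαle.trans (min_le_left _ _)
  have hαh : α ≤ α₀ / 2 := hαle.trans (min_le_right _ _)
  -- the class: `U(b)` unitary, `U(b)⋆ = U(b)⁻¹`, `U(b) ∈ U1`, mutually adjoint transporters
  have hUS : ∀ b, U b ∈ unitaryUnits 𝔸 := fun b => by
    have h := hUG (liftSite b.1) b.2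
    rwa [B9Eq315QTorus.perCfg_apply, perSite_liftSite] at h
  have hUst : ∀ b, star (U b : 𝔸) = (((U b)⁻¹ : 𝔸ˣ) : 𝔸) := forall_star_eq_inv_of_mem hUS
  have hUb : ∀ b, U b ∈ U1 𝔸 := fun b => unitaryUnits_le_U1 (hUS b)
  have hRS := hRS_of_unitary φ τ hφτ hτ₂ U hUst
  -- (52) from the PLAQUETTE window
  have hη : ((L : ℝ) ^ (n + 1))⁻¹ = η := inv_eq_of_mul_eq_one_left hηL
  have h52 : pdev (perCfg (towerP L m (n + 1)) U) < α₀ * (((L : ℝ) ^ (n + 1))⁻¹) ^ 2 := by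
    have hp := pdev_perCfg_le_of_plaq (U := U) hUb (by positivity) hpl
    rw [hη]
    exact lt_of_le_of_lt hp (mul_lt_mul_of_pos_right (by linarith) (by positivity))
  -- every level background unitary ⟹ its fibre transporters preserve the norm
  have hLu : ∀ (j : ℕ) (b : Bond d (towerP L m (j + 1))), star (UlevOf L m (n + 1) U j b : 𝔸) = ((UlevOf L m (n + 1) U j b)⁻¹ : 𝔸ˣ) :=
    UlevOf_star_eq_inv L m n hL2 hUS hα₀ hα3 (by linarith) h52
  have hRlev : ∀ (j : ℕ) (b : Bond d (towerP L m (j + 1))) (w : W), ‖adTransportW φ (UlevOf L m (n + 1) U j) b w‖ ≤ ‖w‖ := fun j b w =>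
    (norm_adTransportW_eq φ (UlevOf L m (n + 1) U j) τ hτ₂ (hLu j) hφτ b w).le
  -- the feed: bond-deviation profile `εU ≤ Kα·L^{−j}`, the windows at `β = Kα`
  obtain ⟨hβ0, hβ1, -, hUη', hpl', hUlev, εU, hεU, hUε, hεg⟩ := F m n (avgClosed_unitaryUnits d L) hUS hηL hα0 hαT' hUη hpl
  have hβ1' : (1 + 512 * (d + 1) * (d + 4)) * α ≤ α₁ := hβ1.trans (min_le_left _ _)
  have hβS : (1 + 512 * (d + 1) * (d + 4)) * α ≤ αS := hβ1.trans ((min_le_right _ _).trans (min_le_left _ _))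
  have hβQ : (1 + 512 * (d + 1) * (d + 4)) * α ≤ αQ := hβ1.trans ((min_le_right _ _).trans ((min_le_right _ _).trans (min_le_left _ _)))
  have hβA : (1 + 512 * (d + 1) * (d + 4)) * α ≤ αA := hβ1.trans ((min_le_right _ _).trans ((min_le_right _ _).trans (min_le_right _ _)))
  have hαβ : α ≤ (1 + 512 * (d + 1) * (d + 4)) * α := by
    have h1 : (1 : ℝ) ≤ 1 + 512 * (d + 1) * (d + 4) := by
      have : (0 : ℝ) ≤ 512 * (d + 1) * (d + 4) := by positivity
      linarith
    exact le_mul_of_one_le_left hα0 h1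
  have hUgrad' : ∀ (x : TSite d (towerP L m (n + 1))) (μ : Fin d), ‖(U (x, μ) : 𝔸) - U (unshift μ x, μ)‖ ≤ (1 + 512 * (d + 1) * (d + 4)) * α * η ^ 2 :=
    fun x μ => (hUgrad x μ).trans (mul_le_mul_of_nonneg_right hαβ (by positivity))
  -- the per-level data at the geometric profile
  have hα0' : ∀ j, 0 ≤ αT d L α₀ * (((L : ℝ) ^ min (j + 1) (n + 1))⁻¹) ^ 2 := geomProfile_nonneg (d := d) L (n + 1) hα₀.le
  have hαL' : ∀ j, 50 * (d + 1) * (αT d L α₀ * (((L : ℝ) ^ min (j + 1) (n + 1))⁻¹) ^ 2) * (L : ℝ) ^ d ≤ 1 / 2 := fun j =>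
    le_trans (mul_le_mul_of_nonneg_right (mul_le_mul_of_nonneg_left (geomProfile_le_αT (d := d) L (n + 1) hL hα₀.le j) (by positivity))
      (by positivity)) hαL
  have hAQ : ∑ j ∈ Finset.range (n + 1), αT d L α₀ * (((L : ℝ) ^ min (j + 1) (n + 1))⁻¹) ^ 2 ≤ αT d L α₀ / 3 :=
    sum_geomProfile_le (d := d) L (n + 1) hL2 hα₀.le
  -- the three positivity witnesses at the produced data
  have hpos' : ∀ x : SiteL2K ℂ d (towerP L m (n + 1)) c₀ W, x ≠ 0 →
      0 < RCLike.re ⟪x, laplacePrimeAk L m n φ η U a' (c₁ := c₁) x⟫_ℂ := fun x hx => by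
    have h := HS n η hηL c₀ c₁ hw m U hRS _ hβ0 hβS hUb hUη' εU hεU hεg hUε hUlev x
    have hx' : 0 < ‖x‖ := norm_pos_iff.2 hx
    have h2 : 0 < γ' * (‖covDerivL2K ℂ c₀ ((η : ℂ))⁻¹ (adTransportW φ (fun _ : Bond d (towerP L m (n + 1)) => (1 : 𝔸ˣ))) x‖ ^ 2 +
        ‖x‖ ^ 2) := mul_pos hγ' (add_pos_of_nonneg_of_pos (sq_nonneg _) (pow_pos hx' 2))
    linarith
  refine ⟨h52, hpos', ?_⟩
  have hposπ : ∀ x : BondL2K ℂ d (towerP L m (n + 1)) c₀ W, x ≠ 0 →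
      0 < RCLike.re ⟪x, laplaceAkPi L m n φ τ η U a' hpos' hL (fun j => αT d L α₀ * (((L : ℝ) ^ min (j + 1) (n + 1))⁻¹) ^ 2)
        (fun j => (geomProfile_le_αT (d := d) L (n + 1) hL hα₀.le j).trans (αT_le hL hα4))
        (ulev_mem_U1_of_pdev L m (n + 1) U hL2 (avgClosed_unitaryUnits d L) hUG hα₀ hα3 hα4 h52)
        (ulev_reg_of_pdev_geometric L m (n + 1) U hL2 (avgClosed_unitaryUnits d L) hUG hα₀ hα3 hα4 h52) (c₁ := c₁) a x⟫_ℂ := fun x hx =>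
    HQ n η hηL c₀ c₁ hw hρ' m U _ _ _ _ εU hεU hUε hβ0 hβQ hRS hUb hUη' hpl' hεg hUlev hpos' x hx
  refine ⟨hposπ, ?_⟩
  have hpos : ∀ x : BondL2K ℂ d (towerP L m (n + 1)) c₀ W, x ≠ 0 →
      0 < RCLike.re ⟪x, laplaceAk L m n φ η U hL (fun j => αT d L α₀ * (((L : ℝ) ^ min (j + 1) (n + 1))⁻¹) ^ 2)
        (fun j => (geomProfile_le_αT (d := d) L (n + 1) hL hα₀.le j).trans (αT_le hL hα4))
        (ulev_mem_U1_of_pdev L m (n + 1) U hL2 (avgClosed_unitaryUnits d L) hUG hα₀ hα3 hα4 h52)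
        (ulev_reg_of_pdev_geometric L m (n + 1) U hL2 (avgClosed_unitaryUnits d L) hUG hα₀ hα3 hα4 h52) τ (c₀ := c₀) (c₁ := c₁) a x⟫_ℂ :=
    fun x hx => HA n η hηL c₀ c₁ hw hρ' m U _ _ _ _ εU hεU hUε hβ0 hβA hRS hUb hUη' hpl' hεg x hx
  -- (I-5) at the produced block (`α := Kα`)
  exact HC n η hηL c₀ c₁ hw hρ' m hm U _ hα0' _ hαL' _ _ εU hεU hUε hUlev _ hβ0 hβ1' hUst hUb hUη' hpl' hUgrad' hRlev hεg hAQ hpos' hpos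
    hc₀η j₀ hJ hj' hposπ _ hUG lev₀ lev₁ levB hlev hw₀ hw₁ hw₃ hwB hW hWa

end Summit.QuantumFields.BalabanUV.T4Continuum.NE9CurChartTowerPiLatticeUniformClass

end
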